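import Summits.QuantumFields.BalabanUV.T4Continuum.Spine.NE2ColourPerturbedLayer

/-!
# T⁴ programme, spine node NE2 (U1a) — THE RESOLVENT ROUTE's ENGINE AT A GENERAL GEOMETRIC RATE `ρ ∈ [L⁻¹, 1)`
# (closer (M1′), ENGINE HALF, of the located currency gap GAPS `G-ne2leaf08g2-1`)

Tenth generation of the NE2 prover lineage P1 of the cell `pub-balaban` (row owner), file 9.  Every tier-A / tier-B file of the resolvent route
concludes `TowerLimitRate … ((L:ℝ)⁻¹)` through the King wrappers `NE2PerturbedLayer.towerLimitRate_perturbed_king` /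
`NE2ColourPerturbedLayer.towerLimitRate_perturbed_king_kron`, which HARD-WIRE the rate `L⁻¹` in the (H-cons) majorant `e₂ k = C₂·L^{−k}`.  The
abstract engine `BackgroundResolventTower.towerLimitRate_perturbed` is RATE-GENERIC (any `ρ < 1`, defects `≤ C·ρ^k`).  Leaf-08-g2's located gap
`G-ne2leaf08g2-1` (mismatch (M1)) observes that node NE3's energy deliverable, read in sup currency through the (3.35)-shape Lipschitz input,
gives the two-level consistencies at a geometric rate `θ = L^{−2k/3}`-per-level type (d = 4), SLOWER than `L⁻¹`; its closer (M1′) is «ROOT B re-run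
at a general rate `ρ ∈ [L⁻¹, 1)`».  THIS FILE is the ENGINE half of (M1′), which costs nothing: the free King tower's complement / injected
defects `2dCst·L^{−k}`, `CJ·L^{−k}` are `≤ 2dCst·ρ^k`, `CJ·ρ^k` for `ρ ≥ L⁻¹`, so

 * `towerLimitRate_perturbed_king_rate` / `towerLimitRate_perturbed_king_kron_rate`: `PerturbationLaws (Δ_a[⊗1]) P (J[⊗1]) κ (k ↦ C₂·ρ^k)`,
   `L⁻¹ ≤ ρ < 1`, `‖t‖κ < 1` ⟹ `TowerLimitRate (Q[⊗1]) L^d (k ↦ (Δ_a^{(k)}[⊗1] + tP_k)⁻¹) (Cpert κ (2dCst) CJ C₂ 0 t) ρ`;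
 * `perturbationLaws_rate_mono`: a law with `e₂ k = C₂·L^{−k}` (`C₂ ≥ 0`) is a law with `e₂ k = C₂·ρ^k` for every `ρ ≥ L⁻¹` (so every landed
   tier-B law already feeds the general-rate engine; what (M1′) still needs is the STRUCTURE half — the `/lev L k` consistency fields of rows B2–B6
   re-typed to `·θ^k` — booked by the owner as row B8, not done here).

HONEST FRAMING (T4-DAG p. 1).  Bookkeeping on the abstract resolvent engine; no new estimate; rates / constants OURS; finite torus, linear layer,
operator norm; NE2 (U1a) NOT PROVED; node NE3 OPEN; spine PROVED 0/9 unchanged; NOT infinite volume / mass gap / Clay.  HONEST DEPENDENCY: continuum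
YM on T⁴ ⇐ BetaPertH ∧ nine spine estimates (0/9 proved); BetaPertH ⇐ (D1) ∧ (D4) ∧ CAP+tail; G-an2-4 gates asym, D1 and NE2/3/4.  No definition, no
`def … : Prop` fact, no `sorry`.
-/

noncomputable section

open scoped BigOperators ComplexConjugate Matrix Matrix.Norms.L2Operator Kronecker
open Filter Topology

namespace Summit.QuantumFields.BalabanUV.T4Continuum.NE2ColourPerturbedLayerRate

open Literature.MathematicalPhysics.QuantumFieldTheory.Balaban1983to89.B5Prop11Plancherel (Cst Cst_nonneg)
open Summit.QuantumFields.BalabanUV.T4Continuum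
open Summit.QuantumFields.BalabanUV.T4Continuum.CovariantAveragingTower (TowerLimitRate)
open Summit.QuantumFields.BalabanUV.T4Continuum.BalabanAveragedTowerUnit (idx Qlev)
open Summit.QuantumFields.BalabanUV.T4Continuum.BackgroundResolventTower
open Summit.QuantumFields.BalabanUV.T4Continuum.KingPairingPlantedLaw
open Summit.QuantumFields.BalabanUV.T4Continuum.NE2PerturbedLayer
open Summit.QuantumFields.BalabanUV.T4Continuum.NE2ColourPerturbedLayer (freeTowerLaws_king_kron pow_d_pos)
open Summit.QuantumFields.BalabanUV.T4Continuum.PerturbationAlgebra (perturbationLaws_mono)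

variable {d : ℕ} (L : ℕ) [NeZero L] (M : Fin d → ℕ) [hM : ∀ μ, NeZero (M μ)] (a : ℝ) (ha : 0 < a)
variable {o : Type*} [Fintype o] [DecidableEq o]

omit [NeZero L] in
/-- `C·L^{−k} ≤ C·ρ^k` for `C ≥ 0` and `L⁻¹ ≤ ρ`. [folklore] -/
theorem const_mul_invPow_le {C ρ : ℝ} (hC : 0 ≤ C) (hρ : ((L : ℝ)⁻¹) ≤ ρ) (k : ℕ) : C * ((L : ℝ)⁻¹) ^ k ≤ C * ρ ^ k :=
  mul_le_mul_of_nonneg_left (pow_le_pow_left₀ (inv_nonneg.mpr (Nat.cast_nonneg L)) hρ k) hC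

omit [NeZero L] in
/-- **RATE MONOTONICITY OF THE TARGET SHAPE**: a `PerturbationLaws` with (H-cons) majorant `C₂·L^{−k}` (`C₂ ≥ 0`) is one with majorant `C₂·ρ^k` for
every `ρ ≥ L⁻¹` — every landed tier-A / tier-B law feeds the general-rate engine below unchanged. [folklore] -/
theorem perturbationLaws_rate_mono {σ : ℕ → Type*} [∀ k, Fintype (σ k)] [∀ k, DecidableEq (σ k)]
    {D : (k : ℕ) → Matrix (σ k) (σ k) ℂ} {P : (k : ℕ) → Matrix (σ k) (σ k) ℂ}
    {J : (k : ℕ) → Matrix (σ (k + 1)) (σ k) ℂ} {κ C₂ ρ : ℝ} (hC₂ : 0 ≤ C₂) (hρ : ((L : ℝ)⁻¹) ≤ ρ)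
    (h : PerturbationLaws D P J κ (fun k => C₂ * ((L : ℝ)⁻¹) ^ k)) : PerturbationLaws D P J κ (fun k => C₂ * ρ ^ k) :=
  perturbationLaws_mono h le_rfl (const_mul_invPow_le L hC₂ hρ)

/-- **THE SCALAR KING ENGINE AT A GENERAL RATE** (`L ≥ 2`, `L⁻¹ ≤ ρ < 1`): `PerturbationLaws Δ_a P J κ (k ↦ C₂·ρ^k)` and `‖t‖κ < 1` ⟹
`TowerLimitRate Q L^d (k ↦ (Δ_a^{(k)} + tP_k)⁻¹) (Cpert κ (2dCst) CJ C₂ 0 t) ρ` — `BackgroundResolventTower.towerLimitRate_perturbed` over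
`freeTowerLaws_king`, the free defects `2dCst·L^{−k}`, `CJ·L^{−k}` majorised by `·ρ^k`. [folklore] -/
theorem towerLimitRate_perturbed_king_rate (hL : 2 ≤ L) {ρ : ℝ} (hρ : ((L : ℝ)⁻¹) ≤ ρ) (hρ1 : ρ < 1)
    {P : (k : ℕ) → Matrix (idx L M k) (idx L M k) ℂ} {κ C₂ : ℝ}
    (hpert : PerturbationLaws (calDalev L M a ha) P (JpcT L M) κ (fun k => C₂ * ρ ^ k)) {t : ℂ} (ht : ‖t‖ * κ < 1) :
    TowerLimitRate (Qlev L M) ((L : ℝ) ^ d) (fun k => (calDalev L M a ha k + t • P k)⁻¹)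
      (Cpert κ (2 * d * Cst d a) (CJ d a) C₂ 0 t) ρ := by
  have hL1 : (1 : ℝ) < L := by exact_mod_cast (lt_of_lt_of_le one_lt_two hL : 1 < L)
  have hr : (0 : ℝ) < (L : ℝ) ^ d := pow_pos (lt_trans zero_lt_one hL1) d
  refine towerLimitRate_perturbed hr (freeTowerLaws_king L M a ha) hpert hρ1
    (const_mul_invPow_le L (by positivity [Cst_nonneg d a]) hρ) (const_mul_invPow_le L (CJ_nonneg d a) hρ) (fun k => le_rfl)
    (fun k => ?_) ht
  simp only [zero_mul, le_refl]

/-- **THE COLOUR KING ENGINE AT A GENERAL RATE** (`L⁻¹ ≤ ρ < 1`): `PerturbationLaws (Δ_a⊗1) P (J⊗1) κ (k ↦ C₂·ρ^k)` and `‖t‖κ < 1` ⟹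
`TowerLimitRate (Q⊗1) L^d (k ↦ (Δ_a^{(k)}⊗1 + tP_k)⁻¹) (Cpert κ (2dCst) CJ C₂ 0 t) ρ`.  This is the END a general-rate tier B (closer (M1′) of
`G-ne2leaf08g2-1`) composes with; at `ρ = L⁻¹` it is `NE2ColourPerturbedLayer.towerLimitRate_perturbed_king_kron`. [folklore] -/
theorem towerLimitRate_perturbed_king_kron_rate {ρ : ℝ} (hρ : ((L : ℝ)⁻¹) ≤ ρ) (hρ1 : ρ < 1)
    {P : (k : ℕ) → Matrix (idx L M k × o) (idx L M k × o) ℂ} {κ C₂ : ℝ}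
    (hpert : PerturbationLaws (fun k => calDalev L M a ha k ⊗ₖ (1 : Matrix o o ℂ)) P (fun k => JpcT L M k ⊗ₖ (1 : Matrix o o ℂ)) κ
      (fun k => C₂ * ρ ^ k)) {t : ℂ} (ht : ‖t‖ * κ < 1) :
    TowerLimitRate (fun k => Qlev L M k ⊗ₖ (1 : Matrix o o ℂ)) ((L : ℝ) ^ d)
      (fun k => (calDalev L M a ha k ⊗ₖ (1 : Matrix o o ℂ) + t • P k)⁻¹) (Cpert κ (2 * d * Cst d a) (CJ d a) C₂ 0 t) ρ := by
  refine towerLimitRate_perturbed (pow_d_pos (d := d) L) (freeTowerLaws_king_kron L M a ha o) hpert hρ1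
    (const_mul_invPow_le L (by positivity [Cst_nonneg d a]) hρ) (const_mul_invPow_le L (CJ_nonneg d a) hρ) (fun k => le_rfl)
    (fun k => ?_) ht
  simp only [zero_mul, le_refl]

/-- **A RATE-`L⁻¹` LAW RUN AT ANY SLOWER GEOMETRIC RATE** (`L⁻¹ ≤ ρ < 1`, `C₂ ≥ 0`): the colour engine applied to `perturbationLaws_rate_mono` —
so the landed ROOT B of record (`NE2BalabanThreshold.balaban_final_rate_of_regular`'s law `NE2BalabanFinal.perturbationLaws_balaban_final`) ALSO
concludes `TowerLimitRate … ρ` for every `ρ ∈ [L⁻¹, 1)`; the general-rate closer (M1′) differs from this only in the STRUCTURE half (NE3's input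
allowed at rate `θ > L⁻¹`). [folklore] -/
theorem towerLimitRate_perturbed_king_kron_of_invRate {ρ : ℝ} (hρ : ((L : ℝ)⁻¹) ≤ ρ) (hρ1 : ρ < 1)
    {P : (k : ℕ) → Matrix (idx L M k × o) (idx L M k × o) ℂ} {κ C₂ : ℝ} (hC₂ : 0 ≤ C₂)
    (hpert : PerturbationLaws (fun k => calDalev L M a ha k ⊗ₖ (1 : Matrix o o ℂ)) P (fun k => JpcT L M k ⊗ₖ (1 : Matrix o o ℂ)) κ
      (fun k => C₂ * ((L : ℝ)⁻¹) ^ k)) {t : ℂ} (ht : ‖t‖ * κ < 1) :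
    TowerLimitRate (fun k => Qlev L M k ⊗ₖ (1 : Matrix o o ℂ)) ((L : ℝ) ^ d)
      (fun k => (calDalev L M a ha k ⊗ₖ (1 : Matrix o o ℂ) + t • P k)⁻¹) (Cpert κ (2 * d * Cst d a) (CJ d a) C₂ 0 t) ρ :=
  towerLimitRate_perturbed_king_kron_rate L M a ha hρ hρ1 (perturbationLaws_rate_mono L hC₂ hρ hpert) ht

end Summit.QuantumFields.BalabanUV.T4Continuum.NE2ColourPerturbedLayerRate

end
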